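import Summits.QuantumFields.YangMills.Theorems.BrascampLiebVacuum.Negative.WilsonTorusToolkit
import Literature.MathematicalPhysics.QuantumLattice.HeatKernelGroupMeasureProofs

/-!
# `ConvexGribovBody.BrascampLiebVacuum` — negative lemma: the time-zero locality hypothesis is
load-bearing (refuter, crux stmt-QuantumFields-8779)

The crux `Summit.QuantumFields.YangMills.Theses.ConvexGribovBody.BrascampLiebVacuum` asks, for
every compact simple `G` and faithful unitary lattice representation `r`, for a Poincaré
inequality `Var_μ f ≤ C · Dmax · dir f` under Wilson's measure `μ` on the torus `(2S+1)⁴`, for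
test functions `f` that are (i) gauge invariant, (ii) functions of the time-zero SPATIAL links
only, (iii) Lipschitz in the link matrices; `dir f` only differentiates along time-zero spatial
links.

* Plaquette traces `U ↦ Re tr ρ(U_p)` (any base point and plane) are gauge invariant
  (`isGaugeInvariant_re_trace_plaquette`), continuous, and link-Lipschitz with constant `4 N⁴` in
  the crux's `Σₑ √fro` modulus (`abs_re_trace_plaquette_sub_le`); `plaquetteHolonomy_update_*`
  compute them on one-link excitations of the trivial configuration (`QuantumLattice.plaquetteHolonomy_one`).
* `brascampLiebVacuum_false_without_locality_at` — for EVERY `(G, r)` admitted by the crux, every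
  `C`, `β` and `S ≥ 1`, the spatial plaquette in the time slice `t = 1` is admissible except for
  (ii) and has `dir f = 0 < Var_μ f`. Hence any proof of the crux must USE hypothesis (ii) (it is
  not decoration), and the natural strengthening "Poincaré for all gauge-invariant link-Lipschitz
  `f` with the time-zero Dirichlet form" is refuted.
* `brascampLiebVacuum_false_without_locality` — the `∃ C, ∃ β₀, ∀ β, ∃ S₀, ∀ S` packaging fails at
  every admissible `(G, r)`.
* `not_brascampLiebVacuum_without_locality` — the global form (the crux with (ii) deleted, written
  out verbatim, is false), modulo the tree's named fact `isSimpleCompactGroup_specialUnitaryGroup`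
  (needed only to exhibit one admissible group, `SU(2)`).
-/

noncomputable section

open scoped BigOperators Topology Matrix Matrix.Norms.Frobenius
open Filter MeasureTheory
open Literature.MathematicalPhysics.QuantumFieldTheory

namespace Summit.QuantumFields.YangMills.Theorems.BrascampLiebVacuum.Negative

/-! ### Plaquette traces as test functions -/

section Plaquette

variable {G : Type*} [Group G] [TopologicalSpace G] [IsTopologicalGroup G] [CompactSpace G]
  [MeasurableSpace G] [BorelSpace G]

omit [MeasurableSpace G] [BorelSpace G] [IsTopologicalGroup G] [CompactSpace G] in
/-- `U ↦ Re tr ρ(U_p)` is gauge invariant (holonomy conjugates, trace is cyclic). [folklore] -/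
theorem isGaugeInvariant_re_trace_plaquette (r : LatticeRep G) {d L : ℕ} (x : Site d L)
    (i j : Fin d) :
    IsGaugeInvariant (fun U : GaugeConfig d L G => (r.ρ (plaquetteHolonomy U x i j)).trace.re) := by
  intro h U
  beta_reduce
  rw [Literature.MathematicalPhysics.QuantumLattice.plaquetteHolonomy_gaugeTransform, map_mul,
    map_mul, Matrix.trace_mul_cycle, ← map_mul, inv_mul_cancel, map_one, one_mul]

omit [MeasurableSpace G] [BorelSpace G] [CompactSpace G] in
/-- `U ↦ Re tr ρ(U_p)` is continuous. [folklore] -/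
theorem continuous_re_trace_plaquette (r : LatticeRep G) {d L : ℕ} (x : Site d L) (i j : Fin d) :
    Continuous (fun U : GaugeConfig d L G => (r.ρ (plaquetteHolonomy U x i j)).trace.re) :=
  Complex.continuous_re.comp (Continuous.matrix_trace (r.continuous.comp
    (Literature.MathematicalPhysics.QuantumLattice.continuous_plaquetteHolonomy x i j)))

omit [MeasurableSpace G] [BorelSpace G] [IsTopologicalGroup G] [CompactSpace G] in
/-- **Link-Lipschitz property of plaquette traces** in the crux's modulus
`Σₑ √fro(ρ(Uₑ) − ρ(Vₑ))`, with constant `4 N⁴`. [folklore] -/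
theorem abs_re_trace_plaquette_sub_le (r : LatticeRep G) {d L : ℕ} [NeZero L] (x : Site d L)
    (i j : Fin d) (U V : GaugeConfig d L G) :
    |(r.ρ (plaquetteHolonomy U x i j)).trace.re - (r.ρ (plaquetteHolonomy V x i j)).trace.re| ≤
      4 * (r.N : ℝ) ^ 4 * ∑ e, Real.sqrt (∑ a, ∑ b, ‖(r.ρ (U e) - r.ρ (V e)) a b‖ ^ 2) := by
  simp_rw [sqrt_sum_sq_eq_norm]
  unfold plaquetteHolonomy
  simp only [map_mul, map_inv_eq_conjTranspose r.ρ r.mem_unitary]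
  rw [← Complex.sub_re, ← Matrix.trace_sub]
  refine (UnitaryCayley.abs_re_trace_le _).trans ?_
  have hN : (0 : ℝ) ≤ r.N := Nat.cast_nonneg _
  have hu : ∀ g, ‖r.ρ g‖ ≤ r.N := fun g =>
    Literature.MathematicalPhysics.QuantumLattice.norm_le_of_mem_unitaryGroup (r.mem_unitary g)
  have huH : ∀ g, ‖(r.ρ g)ᴴ‖ ≤ r.N := fun g => by
    rw [Matrix.frobenius_norm_conjTranspose]; exact hu g
  have h4 := norm_mul₄_sub_mul₄_le (A := r.ρ (U (x, i))) (A' := r.ρ (V (x, i)))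
    (B := r.ρ (U (x.shift i, j))) (B' := r.ρ (V (x.shift i, j)))
    (C := (r.ρ (U (x.shift j, i)))ᴴ) (C' := (r.ρ (V (x.shift j, i)))ᴴ)
    (D := (r.ρ (U (x, j)))ᴴ) (D' := (r.ρ (V (x, j)))ᴴ)
    hN (hu _) (huH _) (huH _) (hu _) (hu _) (huH _)
  rw [← Matrix.conjTranspose_sub, ← Matrix.conjTranspose_sub, Matrix.frobenius_norm_conjTranspose,
    Matrix.frobenius_norm_conjTranspose] at h4
  have hs : ∀ e₀ : Edge d L,
      ‖r.ρ (U e₀) - r.ρ (V e₀)‖ ≤ ∑ e, ‖r.ρ (U e) - r.ρ (V e)‖ := fun e₀ =>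
    Finset.single_le_sum (f := fun e => ‖r.ρ (U e) - r.ρ (V e)‖) (fun _ _ => norm_nonneg _)
      (Finset.mem_univ e₀)
  have hsum := add_le_add (add_le_add (add_le_add (hs (x, i)) (hs (x.shift i, j)))
    (hs (x.shift j, i))) (hs (x, j))
  calc (r.N : ℝ) * ‖_‖ ≤ r.N * ((r.N : ℝ) ^ 3 * (4 * ∑ e, ‖r.ρ (U e) - r.ρ (V e)‖)) := by
        refine mul_le_mul_of_nonneg_left (h4.trans ?_) hN
        refine mul_le_mul_of_nonneg_left ?_ (by positivity)
        linarith
    _ = 4 * (r.N : ℝ) ^ 4 * ∑ e, ‖r.ρ (U e) - r.ρ (V e)‖ := by ring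

omit [MeasurableSpace G] [BorelSpace G] [IsTopologicalGroup G] [CompactSpace G]
  [TopologicalSpace G] in
/-- Exciting the first link of a plaquette of the trivial configuration to `a` gives holonomy `a`,
as soon as `L > 1` and the two directions differ. [folklore] -/
theorem plaquetteHolonomy_update_one {d L : ℕ} [NeZero L] [Fact (1 < L)] (x : Site d L)
    {i j : Fin d} (hij : i ≠ j) (a : G) :
    plaquetteHolonomy (Function.update (1 : GaugeConfig d L G) (x, i) a) x i j = a := by
  have h2 : ((x.shift i, j) : Edge d L) ≠ (x, i) := by simp [Prod.ext_iff, hij.symm]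
  have h3 : ((x.shift j, i) : Edge d L) ≠ (x, i) := by
    intro h
    have := congrArg (fun e : Edge d L => e.1 j) h
    simp [Site.shift] at this
  have h4 : ((x, j) : Edge d L) ≠ (x, i) := by simp [Prod.ext_iff, hij.symm]
  simp [plaquetteHolonomy, Function.update_of_ne h2, Function.update_of_ne h3,
    Function.update_of_ne h4]

omit [MeasurableSpace G] [BorelSpace G] [IsTopologicalGroup G] [CompactSpace G]
  [TopologicalSpace G] in
/-- A plaquette based in the time slice `t = 1` ignores every time-zero link (`S ≥ 1`, so that
`1 ≠ 0` in `ZMod (2S+1)`; the directions are spatial or not — only the base time matters for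
links of direction `≠ 0`, and here both directions are spatial). [folklore] -/
theorem plaquetteHolonomy_update_of_time_zero {S : ℕ} (hS : 1 ≤ S) (U : GaugeConfig 4 (2 * S + 1) G)
    {e : Edge 4 (2 * S + 1)} (he : e.1 0 = 0) (g : G) :
    plaquetteHolonomy (Function.update U e g) (Pi.single 0 1) 1 2 =
      plaquetteHolonomy U (Pi.single 0 1) 1 2 := by
  haveI : Fact (1 < 2 * S + 1) := ⟨by omega⟩
  have hne : ∀ e' : Edge 4 (2 * S + 1), e'.1 0 = 1 → e' ≠ e := fun e' h' heq => by
    rw [heq, he] at h'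
    exact one_ne_zero h'.symm
  have h1 : (((Pi.single 0 1 : Site 4 (2 * S + 1)), (1 : Fin 4)) : Edge 4 (2 * S + 1)) ≠ e :=
    hne _ (by simp)
  have h2 : ((Site.shift (Pi.single 0 1 : Site 4 (2 * S + 1)) 1, (2 : Fin 4)) : Edge 4 (2 * S + 1)) ≠ e :=
    hne _ (by simp [Site.shift])
  have h3 : ((Site.shift (Pi.single 0 1 : Site 4 (2 * S + 1)) 2, (1 : Fin 4)) : Edge 4 (2 * S + 1)) ≠ e :=
    hne _ (by simp [Site.shift])
  have h4 : (((Pi.single 0 1 : Site 4 (2 * S + 1)), (2 : Fin 4)) : Edge 4 (2 * S + 1)) ≠ e :=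
    hne _ (by simp)
  unfold plaquetteHolonomy
  rw [Function.update_of_ne h1, Function.update_of_ne h2, Function.update_of_ne h3,
    Function.update_of_ne h4]

omit [MeasurableSpace G] [BorelSpace G] [IsTopologicalGroup G] in
/-- A compact simple Lie group in the crux's sense is non-abelian, hence non-trivial. [folklore] -/
theorem exists_ne_one_of_isCompactSimpleLieGroup (hG : IsCompactSimpleLieGroup G) :
    ∃ a : G, a ≠ 1 := by
  have hG' := hG.1
  unfold Literature.MathematicalPhysics.QuantumLattice.IsSimpleCompactGroup at hG'
  obtain ⟨-, ⟨a, b, hab⟩, -⟩ := hG'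
  exact ⟨a, fun ha => hab (by rw [ha, one_mul, mul_one])⟩

omit [MeasurableSpace G] [BorelSpace G] [IsTopologicalGroup G] in
/-- In an admissible `(G, r)` some plaquette trace differs from its vacuum value `N`: for `a ≠ 1`
(which exists, `G` being non-abelian) `Re tr ρ(a) < N = Re tr ρ(1)`. [folklore] -/
theorem exists_re_trace_lt (hG : IsCompactSimpleLieGroup G) (r : LatticeRep G) :
    ∃ a : G, (r.ρ a).trace.re < r.N := by
  obtain ⟨a, ha⟩ := exists_ne_one_of_isCompactSimpleLieGroup hG
  have hρa : r.ρ a ≠ 1 := fun h => ha (r.injective (by rw [h, map_one]))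
  exact ⟨a, re_trace_lt_of_ne_one (r.mem_unitary a) hρa⟩

end Plaquette

/-! ### The crux without hypothesis (ii), and its failure -/

section Main

variable {G : Type*} [Group G] [TopologicalSpace G] [IsTopologicalGroup G] [CompactSpace G]
  [MeasurableSpace G] [BorelSpace G]

/-- **Hypothesis (ii) of the crux is load-bearing, for EVERY admissible `(G, r)`, every `C`, every
coupling `β` and every torus `S ≥ 1`.** The slice-one plaquette `f = Re tr ρ(U_p)`, `p` the
`(1,2)`-plaquette based at `(1,0,0,0)`, is gauge invariant and link-Lipschitz (constant `4N⁴`),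
all its time-zero metric slopes vanish identically, so `dir f = 0`, while its variance under
Wilson's measure is positive (the measure charges every open set and `f(1) = N > Re tr ρ(a)` =
`f(1 with one link set to a)` for a suitable `a`). Hence `C · Dmax · dir f = 0 < Var_μ f`. [folklore] -/
theorem brascampLiebVacuum_false_without_locality_at (hG : IsCompactSimpleLieGroup G)
    (r : LatticeRep G) (C β : ℝ) {S : ℕ} (hS : 1 ≤ S) :
    let μ := wilsonMeasure (d := 4) (L := 2 * S + 1) r.ρ β
    let fro : Matrix (Fin r.N) (Fin r.N) ℂ → ℝ := fun M => ∑ a, ∑ b, ‖M a b‖ ^ 2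
    let coul : GaugeConfig 4 (2 * S + 1) G → (Site 4 (2 * S + 1) → G) → ℝ := fun U h =>
      -∑ e : Edge 4 (2 * S + 1),
        (if e.1 0 = 0 ∧ e.2 ≠ 0 then (r.ρ (gaugeTransform h U e)).trace.re else 0)
    let cov : GaugeConfig 4 (2 * S + 1) G → (Site 4 (2 * S + 1) → G) →
        (Fin 3 → ZMod (2 * S + 1)) → ℝ := fun U h p =>
      (∑ j : Fin 3, fro (∑ y : Fin 3 → ZMod (2 * S + 1),
        Complex.exp (-(2 * Real.pi * Complex.I *
          (∑ i : Fin 3, ((p i).val : ℂ) * ((y i).val : ℂ)) / (2 * S + 1 : ℂ))) •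
        ((1 / 2 : ℂ) • (r.ρ (gaugeTransform h U (Fin.cons (0 : ZMod (2 * S + 1)) y, j.succ)) -
          (r.ρ (gaugeTransform h U (Fin.cons (0 : ZMod (2 * S + 1)) y, j.succ)))ᴴ)))) /
        ((2 * S + 1 : ℝ) ^ 3)
    let Dmax : ℝ := ⨆ p : Fin 3 → ZMod (2 * S + 1),
      ∫ U, (⨆ h : {h : Site 4 (2 * S + 1) → G // ∀ h', coul U h ≤ coul U h'}, cov U h.1 p) ∂μ
    let slope : (GaugeConfig 4 (2 * S + 1) G → ℝ) → GaugeConfig 4 (2 * S + 1) G →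
        Edge 4 (2 * S + 1) → ℝ := fun f U e =>
      Filter.limsup (fun g : G => |f (Function.update U e g) - f U| /
        Real.sqrt (fro (r.ρ g - r.ρ (U e)))) (𝓝[≠] (U e))
    let dir : (GaugeConfig 4 (2 * S + 1) G → ℝ) → ℝ := fun f =>
      ∑ e : Edge 4 (2 * S + 1), (if e.1 0 = 0 ∧ e.2 ≠ 0 then ∫ U, (slope f U e) ^ 2 ∂μ else 0)
    ∃ f : GaugeConfig 4 (2 * S + 1) G → ℝ, IsGaugeInvariant f ∧
      (∃ K : ℝ, ∀ U V : GaugeConfig 4 (2 * S + 1) G,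
        |f U - f V| ≤ K * ∑ e, Real.sqrt (fro (r.ρ (U e) - r.ρ (V e)))) ∧
      dir f = 0 ∧ C * Dmax * dir f < ∫ U, (f U - ∫ V, f V ∂μ) ^ 2 ∂μ := by
  intro μ fro coul cov Dmax slope dir
  refine ⟨(fun U : GaugeConfig 4 (2 * S + 1) G => (r.ρ (plaquetteHolonomy U (Pi.single 0 1) 1 2)).trace.re),
    isGaugeInvariant_re_trace_plaquette r _ 1 2,
    ⟨4 * (r.N : ℝ) ^ 4, fun U V => abs_re_trace_plaquette_sub_le r _ 1 2 U V⟩, ?_⟩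
  have hslope : ∀ (U : GaugeConfig 4 (2 * S + 1) G) (e : Edge 4 (2 * S + 1)), e.1 0 = 0 →
      slope (fun U : GaugeConfig 4 (2 * S + 1) G => (r.ρ (plaquetteHolonomy U (Pi.single 0 1) 1 2)).trace.re) U e = 0 := by
    intro U e he
    show Filter.limsup _ _ = 0
    have : (fun g : G => |(r.ρ (plaquetteHolonomy (Function.update U e g) (Pi.single 0 1) 1 2)).trace.re
          - (r.ρ (plaquetteHolonomy U (Pi.single 0 1) 1 2)).trace.re| /
        Real.sqrt (fro (r.ρ g - r.ρ (U e)))) = fun _ => 0 := by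
      funext g
      rw [plaquetteHolonomy_update_of_time_zero hS U he g, sub_self, abs_zero, zero_div]
    rw [this]
    exact limsup_const_zero _
  have hdir : dir (fun U : GaugeConfig 4 (2 * S + 1) G => (r.ρ (plaquetteHolonomy U (Pi.single 0 1) 1 2)).trace.re) = 0 := by
    show (∑ e : Edge 4 (2 * S + 1), (if e.1 0 = 0 ∧ e.2 ≠ 0 then
      ∫ U, (slope (fun U : GaugeConfig 4 (2 * S + 1) G => (r.ρ (plaquetteHolonomy U (Pi.single 0 1) 1 2)).trace.re) U e) ^ 2 ∂μ else 0)) = 0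
    refine Finset.sum_eq_zero fun e _ => ?_
    split_ifs with he
    · simp [hslope _ e he.1]
    · rfl
  refine ⟨hdir, ?_⟩
  rw [hdir, mul_zero]
  haveI : Fact (1 < 2 * S + 1) := ⟨by omega⟩
  haveI : SecondCountableTopology G :=
    (r.continuous.isClosedEmbedding r.injective).isEmbedding.secondCountableTopology
  haveI := isOpenPosMeasure_wilsonMeasure (d := 4) (L := 2 * S + 1) r.ρ r.continuous β
  haveI := isProbabilityMeasure_wilsonMeasure (d := 4) (L := 2 * S + 1) r.ρ r.continuous β
  obtain ⟨a, ha⟩ := exists_re_trace_lt hG r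
  have hne : (fun U : GaugeConfig 4 (2 * S + 1) G => (r.ρ (plaquetteHolonomy U (Pi.single 0 1) 1 2)).trace.re) 1 ≠
      (fun U : GaugeConfig 4 (2 * S + 1) G => (r.ρ (plaquetteHolonomy U (Pi.single 0 1) 1 2)).trace.re)
        (Function.update (1 : GaugeConfig 4 (2 * S + 1) G) ((Pi.single 0 1 : Site 4 (2 * S + 1)), 1) a) := by
    beta_reduce
    rw [Literature.MathematicalPhysics.QuantumLattice.plaquetteHolonomy_one,
      plaquetteHolonomy_update_one _ (by decide) a, map_one, Matrix.trace_one, Fintype.card_fin,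
      Complex.natCast_re]
    exact ha.ne'
  exact integral_sq_sub_pos μ (continuous_re_trace_plaquette r _ 1 2) hne _

/-- **`BrascampLiebVacuum` without (ii) fails at every admissible `(G, r)`**: whatever `C > 0`,
`β₀` and `S₀(β)` are offered, the torus `S = max S₀ 1` at `β = β₀` carries the slice-one plaquette
with `Var_μ f > 0 = C · Dmax · dir f`. Any proof of the crux must therefore USE the restriction to
functions of the time-zero links; the time-zero Dirichlet form alone does not control
gauge-invariant Lipschitz observables living at other times. [folklore] -/
theorem brascampLiebVacuum_false_without_locality (hG : IsCompactSimpleLieGroup G)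
    (r : LatticeRep G) :
    ¬ (∃ C : ℝ, 0 < C ∧ ∃ β₀ : ℝ, ∀ β : ℝ, β₀ ≤ β → ∃ S₀ : ℕ, ∀ S : ℕ, S₀ ≤ S →
    let μ := wilsonMeasure (d := 4) (L := 2 * S + 1) r.ρ β
    let fro : Matrix (Fin r.N) (Fin r.N) ℂ → ℝ := fun M => ∑ a, ∑ b, ‖M a b‖ ^ 2
    let coul : GaugeConfig 4 (2 * S + 1) G → (Site 4 (2 * S + 1) → G) → ℝ := fun U h =>
      -∑ e : Edge 4 (2 * S + 1),
        (if e.1 0 = 0 ∧ e.2 ≠ 0 then (r.ρ (gaugeTransform h U e)).trace.re else 0)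
    let cov : GaugeConfig 4 (2 * S + 1) G → (Site 4 (2 * S + 1) → G) →
        (Fin 3 → ZMod (2 * S + 1)) → ℝ := fun U h p =>
      (∑ j : Fin 3, fro (∑ y : Fin 3 → ZMod (2 * S + 1),
        Complex.exp (-(2 * Real.pi * Complex.I *
          (∑ i : Fin 3, ((p i).val : ℂ) * ((y i).val : ℂ)) / (2 * S + 1 : ℂ))) •
        ((1 / 2 : ℂ) • (r.ρ (gaugeTransform h U (Fin.cons (0 : ZMod (2 * S + 1)) y, j.succ)) -
          (r.ρ (gaugeTransform h U (Fin.cons (0 : ZMod (2 * S + 1)) y, j.succ)))ᴴ)))) /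
        ((2 * S + 1 : ℝ) ^ 3)
    let Dmax : ℝ := ⨆ p : Fin 3 → ZMod (2 * S + 1),
      ∫ U, (⨆ h : {h : Site 4 (2 * S + 1) → G // ∀ h', coul U h ≤ coul U h'}, cov U h.1 p) ∂μ
    let slope : (GaugeConfig 4 (2 * S + 1) G → ℝ) → GaugeConfig 4 (2 * S + 1) G →
        Edge 4 (2 * S + 1) → ℝ := fun f U e =>
      Filter.limsup (fun g : G => |f (Function.update U e g) - f U| /
        Real.sqrt (fro (r.ρ g - r.ρ (U e)))) (𝓝[≠] (U e))
    let dir : (GaugeConfig 4 (2 * S + 1) G → ℝ) → ℝ := fun f =>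
      ∑ e : Edge 4 (2 * S + 1), (if e.1 0 = 0 ∧ e.2 ≠ 0 then ∫ U, (slope f U e) ^ 2 ∂μ else 0)
    ∀ f : GaugeConfig 4 (2 * S + 1) G → ℝ, IsGaugeInvariant f →
      (∃ K : ℝ, ∀ U V : GaugeConfig 4 (2 * S + 1) G,
        |f U - f V| ≤ K * ∑ e, Real.sqrt (fro (r.ρ (U e) - r.ρ (V e)))) →
      ∫ U, (f U - ∫ V, f V ∂μ) ^ 2 ∂μ ≤ C * Dmax * dir f) := by
  rintro ⟨C, -, β₀, h⟩
  obtain ⟨S₀, hS₀⟩ := h β₀ le_rfl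
  have h1 := hS₀ (max S₀ 1) (le_max_left _ _)
  obtain ⟨f, hf₁, hf₃, -, hlt⟩ := brascampLiebVacuum_false_without_locality_at hG r C β₀
    (S := max S₀ 1) (le_max_right _ _)
  exact absurd (h1 f hf₁ hf₃) (not_le.2 hlt)

/-- **The crux with hypothesis (ii) deleted is false** — `ConvexGribovBody.BrascampLiebVacuum`
with the time-zero locality clause `(∀ U V, (∀ e, e.1 0 = 0 → e.2 ≠ 0 → U e = V e) → f U = f V)`
removed and everything else verbatim (same `μ`, `fro`, `coul`, `cov`, `Dmax`, `slope`, `dir`),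
i.e. the natural strengthening "Poincaré for ALL gauge-invariant link-Lipschitz `f` with the
time-zero spatial Dirichlet form" — modulo the tree's named fact
`isSimpleCompactGroup_specialUnitaryGroup` (simplicity of `SU(n)`), needed only to exhibit ONE
group admitted by the hypothesis `IsCompactSimpleLieGroup` (here `SU(2)`, fundamental `r`); the
failure itself is unconditional at every admissible `(G, r)`
(`brascampLiebVacuum_false_without_locality`). [folklore] -/
theorem not_brascampLiebVacuum_without_locality
    (h : Literature.MathematicalPhysics.QuantumLattice.isSimpleCompactGroup_specialUnitaryGroup.{0}) :
    ¬ (∀ (G : Type) [Group G] [TopologicalSpace G] [IsTopologicalGroup G] [CompactSpace G]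
      [MeasurableSpace G] [BorelSpace G], IsCompactSimpleLieGroup G → ∀ r : LatticeRep G,
      ∃ C : ℝ, 0 < C ∧ ∃ β₀ : ℝ, ∀ β : ℝ, β₀ ≤ β → ∃ S₀ : ℕ, ∀ S : ℕ, S₀ ≤ S →
      let μ := wilsonMeasure (d := 4) (L := 2 * S + 1) r.ρ β
      let fro : Matrix (Fin r.N) (Fin r.N) ℂ → ℝ := fun M => ∑ a, ∑ b, ‖M a b‖ ^ 2
      let coul : GaugeConfig 4 (2 * S + 1) G → (Site 4 (2 * S + 1) → G) → ℝ := fun U h =>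
        -∑ e : Edge 4 (2 * S + 1),
          (if e.1 0 = 0 ∧ e.2 ≠ 0 then (r.ρ (gaugeTransform h U e)).trace.re else 0)
      let cov : GaugeConfig 4 (2 * S + 1) G → (Site 4 (2 * S + 1) → G) →
          (Fin 3 → ZMod (2 * S + 1)) → ℝ := fun U h p =>
        (∑ j : Fin 3, fro (∑ y : Fin 3 → ZMod (2 * S + 1),
          Complex.exp (-(2 * Real.pi * Complex.I *
            (∑ i : Fin 3, ((p i).val : ℂ) * ((y i).val : ℂ)) / (2 * S + 1 : ℂ))) •
          ((1 / 2 : ℂ) • (r.ρ (gaugeTransform h U (Fin.cons (0 : ZMod (2 * S + 1)) y, j.succ)) -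
            (r.ρ (gaugeTransform h U (Fin.cons (0 : ZMod (2 * S + 1)) y, j.succ)))ᴴ)))) /
          ((2 * S + 1 : ℝ) ^ 3)
      let Dmax : ℝ := ⨆ p : Fin 3 → ZMod (2 * S + 1),
        ∫ U, (⨆ h : {h : Site 4 (2 * S + 1) → G // ∀ h', coul U h ≤ coul U h'}, cov U h.1 p) ∂μ
      let slope : (GaugeConfig 4 (2 * S + 1) G → ℝ) → GaugeConfig 4 (2 * S + 1) G →
          Edge 4 (2 * S + 1) → ℝ := fun f U e =>
        Filter.limsup (fun g : G => |f (Function.update U e g) - f U| /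
          Real.sqrt (fro (r.ρ g - r.ρ (U e)))) (𝓝[≠] (U e))
      let dir : (GaugeConfig 4 (2 * S + 1) G → ℝ) → ℝ := fun f =>
        ∑ e : Edge 4 (2 * S + 1), (if e.1 0 = 0 ∧ e.2 ≠ 0 then ∫ U, (slope f U e) ^ 2 ∂μ else 0)
      ∀ f : GaugeConfig 4 (2 * S + 1) G → ℝ, IsGaugeInvariant f →
        (∃ K : ℝ, ∀ U V : GaugeConfig 4 (2 * S + 1) G,
          |f U - f V| ≤ K * ∑ e, Real.sqrt (fro (r.ρ (U e) - r.ρ (V e)))) →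
        ∫ U, (f U - ∫ V, f V ∂μ) ^ 2 ∂μ ≤ C * Dmax * dir f) := by
  intro hBL
  have hSU := isCompactSimpleLieGroup_specialUnitaryGroup h (le_refl 2)
  obtain ⟨r⟩ := hSU.2
  exact brascampLiebVacuum_false_without_locality hSU r (hBL _ hSU r)

end Main

end Summit.QuantumFields.YangMills.Theorems.BrascampLiebVacuum.Negative

end
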